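import Literature.NumberTheory.Automorphic.SatakeTransformDuality
import Literature.NumberTheory.Automorphic.CartanIwasawaUniquenessGL
import HarnessLib

/-!
# Duality of the Satake transform of `ℋ(GL_n(F), GL_n(𝒪))`: `#{γ ∈ KgK/K : e(γ) = μ}` against `#{γ ∈ Kg⁻¹K/K : e(γ) = -μ}`
# and the modulus of the Borel as the index `[U(𝒪) : ϖ^μ U(𝒪) ϖ^{-μ}]` (Cartier §IV (4.2); Laumon (4.1.4)–(4.1.6))

Topic `NumberTheory/Automorphic`; namespace `Literature.NumberTheory.Automorphic` (lane `lit-hodgefound`, Track 2 foundations;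
seat `lit-hodgefound-p11`, generation 44, row g44-#2).  THEOREMS ONLY: no definition, no named fact, no instance, no notation.
The `GL_n` instance of the abstract `SatakeTransformDuality` (g44-#1) for the Iwasawa datum `(N·A, GL_n(𝒪), e)` of
`SatakeTransformGLIwasawaDatum` (`P = N·A = {u ϖ^m}`, `K = GL_n(𝒪)`, `e = iwasawaExp`), over any field `F` with a
`ValuativeRel` whose valuation ring is a DVR (any residue field, any characteristic; only the Hecke-pair hypothesis is assumed).

## The mathematics

Here `P ∩ K = U(𝒪)` (upper unitriangular integral matrices) and `P ∩ e⁻¹(0) = U(F)`.  The element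
`t₀ = diag(ϖ^{n-1}, …, ϖ, 1) ∈ P` CONTRACTS: `t₀ U(𝒪) t₀⁻¹ ≤ U(𝒪)` (entry `(i, j)` is multiplied by `ϖ^{j-i}`) and every
`u ∈ U(F)` is conjugated into `U(𝒪)` by a power of `t₀` — `U(F) = ⋃ₖ t₀⁻ᵏ U(𝒪) t₀ᵏ` is the union of compact open subgroups
containing `U(𝒪)` with finite index, so the relative unimodularity hypothesis of g44-#1 holds
(`exists_subgroup_relIndex_ne_zero_gl`).  Consequently (g44-#1 `card_filter_mul_relIndex_eq`), for all `g ∈ GL_n(F)`, `μ ∈ ℤⁿ`: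

  `#{γ ∈ KgK/K : e(γ) = μ} · [ϖ^μU(𝒪)ϖ^{-μ} : U(𝒪) ∩ ϖ^μU(𝒪)ϖ^{-μ}] = #{γ ∈ Kg⁻¹K/K : e(γ) = -μ} · [U(𝒪) : U(𝒪) ∩ ϖ^μU(𝒪)ϖ^{-μ}]`

(`card_filter_iwasawaExp_mul_relIndex_eq`), i.e. `N(g, μ) = δ_B(ϖ^μ) N(g⁻¹, -μ)` with the modulus of the Borel
`δ_B(ϖ^μ) = [U(𝒪) : U(𝒪) ∩ ϖ^μU(𝒪)ϖ^{-μ}] / [ϖ^μU(𝒪)ϖ^{-μ} : U(𝒪) ∩ ϖ^μU(𝒪)ϖ^{-μ}]` (`= Π_{i<j} q^{μ_i - μ_j}`, Laumon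
(4.1.4) `δ_{B(F)}(b) = Π_{i<j} |b_ii/b_jj|`; the closed form is not needed here).  For `μ` ANTITONE (dominant for the upper
triangular Borel) `ϖ^μ` contracts and the second index is `1`: `N(g, μ) = [U(𝒪) : ϖ^μU(𝒪)ϖ^{-μ}] · N(g⁻¹, -μ)`
(`card_filter_iwasawaExp_eq_relIndex_mul_of_antitone`); dually for `μ` monotone.  With Bruhat–Tits (4.4.4) (ii)
(`card_filter_iwasawaExp_orbit_zpowDiagGL_eq_one`: the antidominant extreme coset is unique) this computes the number of left
cosets of `K ϖ^{-a} K` at the DOMINANT extreme: `#{γ ∈ Kϖ^{-a}K/K : e(γ) = -a} = [ϖ^aU(𝒪)ϖ^{-a} : U(𝒪)]` for `a` monotone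
(`card_filter_iwasawaExp_orbit_zpowDiagGL_neg_eq_relIndex`) — the modulus as a coset count.

## What is formalised (theorems only)

* §1 `exists_uniformizer_pow_mul_mem_integer` (`ϖᵏ x ∈ 𝒪` for `k ≫ 0`), `zpowDiagGL_pow_natCast_smul`, `blockTriangular_of_mem_unipotentTorusGL`,
  `coe_conj_zpowDiagGL_apply` (entries of `ϖ^λ x ϖ^{-λ}`), `conj_zpowDiagGL_mem_glInt_of_antitone`,
  **`conjAct_zpowDiagGL_smul_inf_le_of_antitone`** (`ϖ^λ U(𝒪) ϖ^{-λ} ≤ U(𝒪)` for `λ` antitone),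
  `eq_of_mem_unipotentTorusGL_of_iwasawaExp_eq_zero` (`P ∩ e⁻¹(0) = U`), **`exists_conj_pow_mem_glInt`** (a power of
  `diag(ϖ^{n-1}, …, 1)` conjugates any `u ∈ U(F)` into `GL_n(𝒪)`), **`exists_subgroup_relIndex_ne_zero_gl`** (the
  unimodularity hypothesis of g44-#1 for `GL_n`).
* §2 **`card_filter_iwasawaExp_mul_relIndex_eq`** (THE DUALITY for `GL_n`), `card_filter_iwasawaExp_eq_relIndex_mul_of_antitone`,
  `card_filter_iwasawaExp_mul_relIndex_eq_of_monotone`, **`card_filter_iwasawaExp_orbit_zpowDiagGL_neg_eq_relIndex`**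
  (dominant-extreme count = `[ϖ^aU(𝒪)ϖ^{-a} : U(𝒪)]`), `relIndex_conj_zpowDiagGL_mul` (the index ratio is multiplicative in `μ`).
* §3 `satakeTransform_gl_doubleCosetOperator_eq_domCongr_neg` (`𝒮_w(T_g) = ι 𝒮_{w'}(T_{g⁻¹})` for weights absorbing the
  modulus, any commutative `R`).

## References
* [CartierCorvallis1979] P. Cartier, *Representations of 𝔭-adic groups: a survey*, PSPM 33.1 (1979), §I.3, §IV (4.2), Thm. 4.1.
* [Laumon1995] G. Laumon, *Cohomology of Drinfeld Modular Varieties I*, CUP, (4.1.3)–(4.1.6), (4.1.17)–(4.1.18).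
* [BruhatTits1972] F. Bruhat, J. Tits, *Groupes réductifs sur un corps local I*, Publ. Math. IHÉS 41 (1972), Prop. (4.4.4).
* [Macdonald1995] I. G. Macdonald, *Symmetric Functions and Hall Polynomials*, 2nd ed. (1995), Ch. V (2.6)–(2.7), §3.
-/

noncomputable section

open scoped Pointwise MatrixGroups
open MulAction ValuativeRel Matrix Finset MonoidAlgebra ConjAct

namespace Literature.NumberTheory.Automorphic

variable {F : Type*} [Field F] [ValuativeRel F] {n : ℕ}

/-! ## §1 The unipotent radical is the union of the compact open subgroups `t₀⁻ᵏ U(𝒪) t₀ᵏ` -/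

/-- Every element of `F` becomes integral after multiplication by a power of the uniformiser.
[cite: CartierCorvallis1979, §IV (4.2)] -/
theorem exists_uniformizer_pow_mul_mem_integer [IsDiscreteValuationRing 𝒪[F]] {ϖ : F} (hϖ : IsUniformizingElement ϖ) (x : F) :
    ∃ k : ℕ, ∀ j : ℕ, k ≤ j → ϖ ^ j * x ∈ 𝒪[F] := by
  by_cases hx : x = 0
  · exact ⟨0, fun j _ => by rw [hx, mul_zero]; exact Subring.zero_mem _⟩
  obtain ⟨a, e, he, rfl⟩ := exists_eq_zpow_mul_of_ne_zero hϖ hx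
  have heO : e ∈ 𝒪[F] := (Valuation.mem_integer_iff _ _).2 he.le
  refine ⟨(-a).toNat, fun j hj => ?_⟩
  have hja : 0 ≤ (j : ℤ) + a := by have := Int.self_le_toNat (-a); omega
  rw [← mul_assoc, ← zpow_natCast, ← zpow_add₀ hϖ.ne_zero, show (j : ℤ) + a = (((j : ℤ) + a).toNat : ℕ) by
    rw [Int.toNat_of_nonneg hja], zpow_natCast]
  exact Subring.mul_mem _ (Subring.pow_mem _ hϖ.mem _) heO

/-- Finitely many elements become integral after multiplication by one common power of `ϖ`.
[cite: CartierCorvallis1979, §IV (4.2)] -/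
theorem exists_uniformizer_pow_mul_mem_integer_forall [IsDiscreteValuationRing 𝒪[F]] {ϖ : F} (hϖ : IsUniformizingElement ϖ)
    {ι : Type*} [Finite ι] (x : ι → F) : ∃ k : ℕ, ∀ i, ∀ j : ℕ, k ≤ j → ϖ ^ j * x i ∈ 𝒪[F] := by
  classical
  haveI := Fintype.ofFinite ι
  choose k hk using fun i => exists_uniformizer_pow_mul_mem_integer hϖ (x i)
  refine ⟨Finset.univ.sup k, fun i j hj => hk i j ((Finset.le_sup (Finset.mem_univ i)).trans hj)⟩

omit [ValuativeRel F] in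
/-- Elements of `P = N·A` are upper triangular. [cite: CartierCorvallis1979, §IV (4.2)] -/
theorem blockTriangular_of_mem_unipotentTorusGL {ϖ : F} (hϖ0 : ϖ ≠ 0) {x : GL (Fin n) F} (hx : x ∈ unipotentTorusGL hϖ0) :
    ((x : GL (Fin n) F) : Matrix (Fin n) (Fin n) F).BlockTriangular id := by
  obtain ⟨u, hu, m, rfl⟩ := hx
  rw [Units.val_mul]
  exact (blockTriangular_of_mem_upperUnitriangular hu).mul (blockTriangular_zpowDiagGL hϖ0 m)

omit [ValuativeRel F] in
/-- Entries of the conjugate: `(ϖ^lam x ϖ^{-lam})_{ij} = ϖ^{lam_i - lam_j} x_{ij}`. [cite: BruhatTits1972, Prop. (4.4.4) (ii)] -/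
theorem coe_conj_zpowDiagGL_apply {ϖ : F} (hϖ0 : ϖ ≠ 0) (lam : Fin n → ℤ) (x : GL (Fin n) F) (i j : Fin n) :
    ((zpowDiagGL hϖ0 lam * x * (zpowDiagGL hϖ0 lam)⁻¹ : GL (Fin n) F) : Matrix (Fin n) (Fin n) F) i j =
      ϖ ^ (lam i - lam j) * (x : Matrix (Fin n) (Fin n) F) i j := by
  have h := coe_zpowDiagGL_inv_mul_mul_zpowDiagGL_apply hϖ0 (-lam) x i j
  rwa [zpowDiagGL_neg, inv_inv, Pi.neg_apply, Pi.neg_apply, sub_neg_eq_add, neg_add_eq_sub] at h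

omit [ValuativeRel F] in
/-- As an action: `toConjAct (ϖ^lam) • x = ϖ^lam x ϖ^{-lam}`. [cite: CartierCorvallis1979, §IV (4.2)] -/
theorem toConjAct_zpowDiagGL_smul {ϖ : F} (hϖ0 : ϖ ≠ 0) (lam : Fin n → ℤ) (x : GL (Fin n) F) :
    toConjAct (zpowDiagGL hϖ0 lam) • x = zpowDiagGL hϖ0 lam * x * (zpowDiagGL hϖ0 lam)⁻¹ :=
  toConjAct_smul _ _

/-- **Conjugation by `ϖ^lam`, `lam` antitone, keeps an upper triangular integral matrix integral**: if `x ∈ P ∩ GL_n(𝒪)` then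
`ϖ^lam x ϖ^{-lam} ∈ GL_n(𝒪)` (entry `(i,j)`, `i ≤ j`, is multiplied by `ϖ^{lam_i - lam_j} ∈ 𝒪`). [cite: BruhatTits1972, Prop. (4.4.4) (ii)] -/
theorem conj_zpowDiagGL_mem_glInt_of_antitone [IsDiscreteValuationRing 𝒪[F]] {ϖ : F} (hϖ : IsUniformizingElement ϖ)
    {lam : Fin n → ℤ} (hlam : Antitone lam) {x : GL (Fin n) F} (hxP : x ∈ unipotentTorusGL hϖ.ne_zero)
    (hxK : x ∈ glInt n F) :
    zpowDiagGL hϖ.ne_zero lam * x * (zpowDiagGL hϖ.ne_zero lam)⁻¹ ∈ glInt n F := by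
  -- both `x` and `x⁻¹` are upper triangular and integral
  have key : ∀ y : GL (Fin n) F, y ∈ unipotentTorusGL hϖ.ne_zero → (∀ i j, (y : Matrix (Fin n) (Fin n) F) i j ∈ 𝒪[F]) →
      ∀ i j, ((zpowDiagGL hϖ.ne_zero lam * y * (zpowDiagGL hϖ.ne_zero lam)⁻¹ : GL (Fin n) F) :
        Matrix (Fin n) (Fin n) F) i j ∈ 𝒪[F] := by
    intro y hyP hyO i j
    rw [coe_conj_zpowDiagGL_apply]
    rcases lt_or_ge j i with hji | hij
    · rw [blockTriangular_of_mem_unipotentTorusGL hϖ.ne_zero hyP hji, mul_zero]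
      exact Subring.zero_mem _
    · have hnn : 0 ≤ lam i - lam j := sub_nonneg.2 (hlam hij)
      rw [show lam i - lam j = ((lam i - lam j).toNat : ℕ) by rw [Int.toNat_of_nonneg hnn], zpow_natCast]
      exact Subring.mul_mem _ (Subring.pow_mem _ hϖ.mem _) (hyO i j)
  rw [mem_glInt_iff] at hxK ⊢
  refine ⟨key x hxP hxK.1, fun i j => ?_⟩
  have e : (zpowDiagGL hϖ.ne_zero lam * x * (zpowDiagGL hϖ.ne_zero lam)⁻¹)⁻¹ =
      zpowDiagGL hϖ.ne_zero lam * x⁻¹ * (zpowDiagGL hϖ.ne_zero lam)⁻¹ := by group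
  rw [e]
  exact key x⁻¹ ((unipotentTorusGL hϖ.ne_zero).inv_mem hxP) hxK.2 i j

/-- **`ϖ^lam (P ∩ K) ϖ^{-lam} ≤ P ∩ K` for `lam` antitone**: conjugation by a dominant torus element contracts `U(𝒪)`.
[cite: CartierCorvallis1979, §IV (4.2)] -/
theorem conjAct_zpowDiagGL_smul_inf_le_of_antitone [IsDiscreteValuationRing 𝒪[F]] {ϖ : F} (hϖ : IsUniformizingElement ϖ)
    {lam : Fin n → ℤ} (hlam : Antitone lam) :
    toConjAct (zpowDiagGL hϖ.ne_zero lam) • (unipotentTorusGL hϖ.ne_zero ⊓ glInt n F) ≤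
      unipotentTorusGL hϖ.ne_zero ⊓ glInt n F := by
  intro y hy
  rw [Subgroup.mem_pointwise_smul_iff_inv_smul_mem, ← toConjAct_inv, toConjAct_inv_smul] at hy
  obtain ⟨hyP, hyK⟩ := Subgroup.mem_inf.1 hy
  have e : y = zpowDiagGL hϖ.ne_zero lam * ((zpowDiagGL hϖ.ne_zero lam)⁻¹ * y * zpowDiagGL hϖ.ne_zero lam) *
      (zpowDiagGL hϖ.ne_zero lam)⁻¹ := by group
  refine Subgroup.mem_inf.2 ⟨?_, ?_⟩
  · rw [e]
    exact (unipotentTorusGL hϖ.ne_zero).mul_mem ((unipotentTorusGL hϖ.ne_zero).mul_mem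
      (zpowDiagGL_mem_unipotentTorusGL hϖ.ne_zero lam) hyP) ((unipotentTorusGL hϖ.ne_zero).inv_mem
        (zpowDiagGL_mem_unipotentTorusGL hϖ.ne_zero lam))
  · rw [e]
    exact conj_zpowDiagGL_mem_glInt_of_antitone hϖ hlam hyP hyK

/-- **`P ∩ e⁻¹(0) = U`**: an element of `N·A` with Iwasawa exponent `0` is upper unitriangular.
[cite: CartierCorvallis1979, §IV (4.2)] -/
theorem mem_upperUnitriangular_of_iwasawaExp_eq_zero [IsDiscreteValuationRing 𝒪[F]] {ϖ : F} (hϖ : IsUniformizingElement ϖ)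
    {y : GL (Fin n) F} (hy : y ∈ unipotentTorusGL hϖ.ne_zero) (hey : iwasawaExp hϖ y = 0) :
    y ∈ upperUnitriangular (Fin n) F := by
  obtain ⟨u, hu, m, rfl⟩ := hy
  rw [iwasawaExp_unipotent_mul_zpowDiagGL hϖ hu] at hey
  rw [hey, zpowDiagGL_zero, mul_one]
  exact hu

omit [ValuativeRel F] in
/-- Powers of `ϖ^lam`: `(ϖ^lam)^k = ϖ^{k lam}`. [cite: CartierCorvallis1979, §IV (4.2)] -/
theorem zpowDiagGL_pow_natCast_smul {ϖ : F} (hϖ0 : ϖ ≠ 0) (lam : Fin n → ℤ) (k : ℕ) :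
    zpowDiagGL hϖ0 lam ^ k = zpowDiagGL hϖ0 ((k : ℤ) • lam) := by
  induction k with
  | zero => rw [pow_zero, Nat.cast_zero, zero_smul, zpowDiagGL_zero]
  | succ k ih => rw [pow_succ, ih, ← zpowDiagGL_add, Nat.cast_succ, add_smul, one_smul]

/-- **Every `u ∈ U(F)` is conjugated into `GL_n(𝒪)` by a power of `t₀ = diag(ϖ^{n-1}, …, ϖ, 1)`**: the entry `(i, j)`, `i < j`,
of `t₀ᵏ u t₀⁻ᵏ` is `ϖ^{k(j-i)} u_{ij}`. [cite: CartierCorvallis1979, §IV (4.2)] -/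
theorem exists_conj_pow_mem_glInt [IsDiscreteValuationRing 𝒪[F]] {ϖ : F} (hϖ : IsUniformizingElement ϖ)
    {u : GL (Fin n) F} (hu : u ∈ upperUnitriangular (Fin n) F) :
    ∃ k : ℕ, toConjAct (zpowDiagGL hϖ.ne_zero (fun i : Fin n => (n : ℤ) - 1 - (i : ℕ)) ^ k) • u ∈ glInt n F := by
  -- one power of `ϖ` making all entries of `u` and `u⁻¹` integral
  obtain ⟨k, hk⟩ := exists_uniformizer_pow_mul_mem_integer_forall hϖ
    (fun p : (Fin n × Fin n) ⊕ (Fin n × Fin n) => p.elim (fun ij => (u : Matrix (Fin n) (Fin n) F) ij.1 ij.2)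
      (fun ij => ((u⁻¹ : GL (Fin n) F) : Matrix (Fin n) (Fin n) F) ij.1 ij.2))
  refine ⟨k, ?_⟩
  set lam : Fin n → ℤ := fun i => (n : ℤ) - 1 - (i : ℕ) with hlam
  rw [zpowDiagGL_pow_natCast_smul, toConjAct_smul]
  have key : ∀ y : GL (Fin n) F, y ∈ upperUnitriangular (Fin n) F →
      (∀ i j : Fin n, ∀ l : ℕ, k ≤ l → ϖ ^ l * (y : Matrix (Fin n) (Fin n) F) i j ∈ 𝒪[F]) →
      ∀ i j, ((zpowDiagGL hϖ.ne_zero ((k : ℤ) • lam) * y * (zpowDiagGL hϖ.ne_zero ((k : ℤ) • lam))⁻¹ : GL (Fin n) F) :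
        Matrix (Fin n) (Fin n) F) i j ∈ 𝒪[F] := by
    intro y hy hyO i j
    rw [coe_conj_zpowDiagGL_apply]
    rcases lt_trichotomy j i with hji | rfl | hij
    · rw [blockTriangular_of_mem_upperUnitriangular hy hji, mul_zero]
      exact Subring.zero_mem _
    · rw [sub_self, zpow_zero, one_mul, apply_self_of_mem_upperUnitriangular hy]
      exact Subring.one_mem _
    · have hij' : (i : ℕ) + 1 ≤ (j : ℕ) := hij
      have hexp : ((k : ℤ) • lam) i - ((k : ℤ) • lam) j = ((k * ((j : ℕ) - (i : ℕ)) : ℕ) : ℤ) := by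
        simp only [hlam, Pi.smul_apply, smul_eq_mul]
        push_cast [Nat.cast_sub hij.le]
        ring
      rw [hexp, zpow_natCast]
      exact hyO i j _ (Nat.le_mul_of_pos_right k (by omega))
  rw [mem_glInt_iff]
  refine ⟨key u hu (fun i j l hl => hk (Sum.inl (i, j)) l hl), fun i j => ?_⟩
  have e : (zpowDiagGL hϖ.ne_zero ((k : ℤ) • lam) * u * (zpowDiagGL hϖ.ne_zero ((k : ℤ) • lam))⁻¹)⁻¹ =
      zpowDiagGL hϖ.ne_zero ((k : ℤ) • lam) * u⁻¹ * (zpowDiagGL hϖ.ne_zero ((k : ℤ) • lam))⁻¹ := by group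
  rw [e]
  exact key u⁻¹ ((upperUnitriangular (Fin n) F).inv_mem hu) (fun i j l hl => hk (Sum.inr (i, j)) l hl) i j

/-- `t₀ = diag(ϖ^{n-1}, …, ϖ, 1)` has antitone exponents. [cite: CartierCorvallis1979, §IV (4.2)] -/
theorem antitone_sub_val : Antitone (fun i : Fin n => (n : ℤ) - 1 - (i : ℕ)) := by
  intro i j hij
  have : (i : ℕ) ≤ (j : ℕ) := hij
  simp only
  omega

/-- **THE RELATIVE UNIMODULARITY HYPOTHESIS FOR `GL_n`**: every `y ∈ P = N·A` with `e(y) = 0` (i.e. `y ∈ U(F)`) lies in a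
subgroup `V ⊇ P ∩ GL_n(𝒪) = U(𝒪)` with `[V : U(𝒪)] < ∞` (namely `V = t₀⁻ᵏ U(𝒪) t₀ᵏ`).
[cite: CartierCorvallis1979, §I.3, §IV (4.2)] -/
theorem exists_subgroup_relIndex_ne_zero_gl [IsDiscreteValuationRing 𝒪[F]] {ϖ : F} (hϖ : IsUniformizingElement ϖ)
    [IsHeckeTriple (⊤ : Submonoid (GL (Fin n) F)) (glInt n F) (glInt n F)] :
    ∀ y ∈ unipotentTorusGL (n := n) hϖ.ne_zero, iwasawaExp hϖ y = 0 →
      ∃ V : Subgroup (GL (Fin n) F), y ∈ V ∧ unipotentTorusGL hϖ.ne_zero ⊓ glInt n F ≤ V ∧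
        (unipotentTorusGL hϖ.ne_zero ⊓ glInt n F).relIndex V ≠ 0 :=
  IsIwasawaExponent.exists_subgroup_relIndex_ne_zero_of_contracting (a := iwasawaExp hϖ)
    (zpowDiagGL_mem_unipotentTorusGL hϖ.ne_zero _) (conjAct_zpowDiagGL_smul_inf_le_of_antitone hϖ antitone_sub_val)
    fun _ hy hey => exists_conj_pow_mem_glInt hϖ (mem_upperUnitriangular_of_iwasawaExp_eq_zero hϖ hy hey)

/-! ## §2 The duality for `GL_n` -/

section Duality

variable [IsDiscreteValuationRing 𝒪[F]] {ϖ : F} (hϖ : IsUniformizingElement ϖ)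
  [IsHeckeTriple (⊤ : Submonoid (GL (Fin n) F)) (glInt n F) (glInt n F)]
include hϖ

/-- **DUALITY FOR `GL_n`**: for every `g ∈ GL_n(F)` and `μ ∈ ℤⁿ`,
`#{γ ∈ KgK/K : e(γ) = μ} · [ϖ^μU(𝒪)ϖ^{-μ} : U(𝒪) ∩ ϖ^μU(𝒪)ϖ^{-μ}] = #{γ ∈ Kg⁻¹K/K : e(γ) = -μ} · [U(𝒪) : U(𝒪) ∩ ϖ^μU(𝒪)ϖ^{-μ}]`
(`K = GL_n(𝒪)`, `U(𝒪) = N·A ∩ K`): the coefficient of `x^μ` in the counting transform of `T_g` is `δ_B(ϖ^μ)` times the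
coefficient of `x^{-μ}` in that of `T_{g⁻¹}`. [cite: CartierCorvallis1979, §IV (4.2)] [cite: Laumon1995, (4.1.4)–(4.1.6)] -/
theorem card_filter_iwasawaExp_mul_relIndex_eq (g : GL (Fin n) F) (μ : Fin n → ℤ)
    [DecidablePred fun α : GL (Fin n) F ⧸ glInt n F => iwasawaExp hϖ α.out = μ]
    [DecidablePred fun α : GL (Fin n) F ⧸ glInt n F => iwasawaExp hϖ α.out = -μ] :
    ((finite_orbit_quotient (glInt n F) g).toFinset.filter (fun α => iwasawaExp hϖ α.out = μ)).card *
        (unipotentTorusGL hϖ.ne_zero ⊓ glInt n F).relIndex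
          (toConjAct (zpowDiagGL hϖ.ne_zero μ) • (unipotentTorusGL hϖ.ne_zero ⊓ glInt n F)) =
      ((finite_orbit_quotient (glInt n F) g⁻¹).toFinset.filter (fun α => iwasawaExp hϖ α.out = -μ)).card *
        (toConjAct (zpowDiagGL hϖ.ne_zero μ) • (unipotentTorusGL hϖ.ne_zero ⊓ glInt n F)).relIndex
          (unipotentTorusGL hϖ.ne_zero ⊓ glInt n F) := by
  have hμ : iwasawaExp hϖ (zpowDiagGL hϖ.ne_zero μ) = μ := iwasawaExp_zpowDiagGL_gl hϖ μ
  have key := (isIwasawaExponent_gl hϖ).card_filter_mul_relIndex_eq (exists_subgroup_relIndex_ne_zero_gl hϖ) g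
    (t := zpowDiagGL hϖ.ne_zero μ) (zpowDiagGL_mem_unipotentTorusGL hϖ.ne_zero μ)
  simp only [hμ] at key
  convert key using 2

/-- **Dominant exponents**: for `μ` ANTITONE, `ϖ^μ` contracts `U(𝒪)`, so
`#{γ ∈ KgK/K : e(γ) = μ} = #{γ ∈ Kg⁻¹K/K : e(γ) = -μ} · [U(𝒪) : ϖ^μU(𝒪)ϖ^{-μ}]`. [cite: CartierCorvallis1979, §IV (4.2)] -/
theorem card_filter_iwasawaExp_eq_relIndex_mul_of_antitone (g : GL (Fin n) F) {μ : Fin n → ℤ} (hμ : Antitone μ)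
    [DecidablePred fun α : GL (Fin n) F ⧸ glInt n F => iwasawaExp hϖ α.out = μ]
    [DecidablePred fun α : GL (Fin n) F ⧸ glInt n F => iwasawaExp hϖ α.out = -μ] :
    ((finite_orbit_quotient (glInt n F) g).toFinset.filter (fun α => iwasawaExp hϖ α.out = μ)).card =
      ((finite_orbit_quotient (glInt n F) g⁻¹).toFinset.filter (fun α => iwasawaExp hϖ α.out = -μ)).card *
        (toConjAct (zpowDiagGL hϖ.ne_zero μ) • (unipotentTorusGL hϖ.ne_zero ⊓ glInt n F)).relIndex
          (unipotentTorusGL hϖ.ne_zero ⊓ glInt n F) := by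
  have h := card_filter_iwasawaExp_mul_relIndex_eq hϖ g μ
  rwa [Subgroup.relIndex_eq_one.2 (conjAct_zpowDiagGL_smul_inf_le_of_antitone hϖ hμ), mul_one] at h

/-- **Antidominant exponents**: for `μ` MONOTONE, `ϖ^{-μ}` contracts, so
`#{γ ∈ KgK/K : e(γ) = μ} · [ϖ^μU(𝒪)ϖ^{-μ} : U(𝒪)] = #{γ ∈ Kg⁻¹K/K : e(γ) = -μ}`. [cite: CartierCorvallis1979, §IV (4.2)] -/
theorem card_filter_iwasawaExp_mul_relIndex_eq_of_monotone (g : GL (Fin n) F) {μ : Fin n → ℤ} (hμ : Monotone μ)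
    [DecidablePred fun α : GL (Fin n) F ⧸ glInt n F => iwasawaExp hϖ α.out = μ]
    [DecidablePred fun α : GL (Fin n) F ⧸ glInt n F => iwasawaExp hϖ α.out = -μ] :
    ((finite_orbit_quotient (glInt n F) g).toFinset.filter (fun α => iwasawaExp hϖ α.out = μ)).card *
        (unipotentTorusGL hϖ.ne_zero ⊓ glInt n F).relIndex
          (toConjAct (zpowDiagGL hϖ.ne_zero μ) • (unipotentTorusGL hϖ.ne_zero ⊓ glInt n F)) =
      ((finite_orbit_quotient (glInt n F) g⁻¹).toFinset.filter (fun α => iwasawaExp hϖ α.out = -μ)).card := by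
  have h := card_filter_iwasawaExp_mul_relIndex_eq hϖ g μ
  -- `ϖ^{-μ} U(𝒪) ϖ^{μ} ≤ U(𝒪)`, i.e. `U(𝒪) ≤ ϖ^μ U(𝒪) ϖ^{-μ}`
  have hle : unipotentTorusGL hϖ.ne_zero ⊓ glInt n F ≤
      toConjAct (zpowDiagGL hϖ.ne_zero μ) • (unipotentTorusGL hϖ.ne_zero ⊓ glInt n F) := by
    have h' := conjAct_zpowDiagGL_smul_inf_le_of_antitone hϖ (lam := -μ) hμ.neg
    have e : toConjAct (zpowDiagGL hϖ.ne_zero (-μ)) = (toConjAct (zpowDiagGL hϖ.ne_zero μ))⁻¹ := by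
      rw [zpowDiagGL_neg, toConjAct_inv]
    rw [e] at h'
    have h'' := Subgroup.pointwise_smul_le_pointwise_smul_iff (a := toConjAct (zpowDiagGL hϖ.ne_zero μ)) |>.2 h'
    rwa [smul_inv_smul] at h''
  rwa [Subgroup.relIndex_eq_one.2 hle, mul_one] at h

/-- **The dominant extreme count is the modulus**: for `a` monotone, the number of left cosets of `K ϖ^{-a} K` with Iwasawa
exponent `-a` (the dominant extreme of that double coset) is the index `[ϖ^aU(𝒪)ϖ^{-a} : U(𝒪)]` — by duality from the
antidominant count `#{γ ∈ Kϖ^aK/K : e(γ) = a} = 1` (Bruhat–Tits (4.4.4) (ii)). [cite: BruhatTits1972, Prop. (4.4.4) (ii)]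
[cite: CartierCorvallis1979, §IV (4.2)] -/
theorem card_filter_iwasawaExp_orbit_zpowDiagGL_neg_eq_relIndex {a : Fin n → ℤ} (ha : Monotone a)
    [DecidablePred fun α : GL (Fin n) F ⧸ glInt n F => iwasawaExp hϖ α.out = -a] :
    ((finite_orbit_quotient (glInt n F) (zpowDiagGL hϖ.ne_zero (-a))).toFinset.filter
        (fun α => iwasawaExp hϖ α.out = -a)).card =
      (unipotentTorusGL hϖ.ne_zero ⊓ glInt n F).relIndex
        (toConjAct (zpowDiagGL hϖ.ne_zero a) • (unipotentTorusGL hϖ.ne_zero ⊓ glInt n F)) := by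
  classical
  have h := card_filter_iwasawaExp_mul_relIndex_eq_of_monotone hϖ (zpowDiagGL hϖ.ne_zero a) ha
  rw [card_filter_iwasawaExp_orbit_zpowDiagGL_eq_one hϖ ha, one_mul, ← zpowDiagGL_neg] at h
  exact h.symm

omit [IsDiscreteValuationRing 𝒪[F]] in
/-- **The index ratio is multiplicative in `μ`** (the modulus `δ_B(ϖ^μ)` is a character of `ℤⁿ`):
`[U : U ∩ ϖ^{μ+μ'}U] · [ϖ^μU : U ∩ ϖ^μU] · [ϖ^{μ'}U : U ∩ ϖ^{μ'}U] = [ϖ^{μ+μ'}U : U ∩ ϖ^{μ+μ'}U] · [U : U ∩ ϖ^μU] · [U : U ∩ ϖ^{μ'}U]`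
(`U = U(𝒪)`, conjugates abbreviated). [cite: CartierCorvallis1979, §I.3] [cite: Laumon1995, (4.1.4)] -/
theorem relIndex_conj_zpowDiagGL_mul (μ μ' : Fin n → ℤ) :
    (toConjAct (zpowDiagGL hϖ.ne_zero (μ + μ')) • (unipotentTorusGL hϖ.ne_zero ⊓ glInt n F)).relIndex
          (unipotentTorusGL hϖ.ne_zero ⊓ glInt n F) *
        (unipotentTorusGL hϖ.ne_zero ⊓ glInt n F).relIndex
          (toConjAct (zpowDiagGL hϖ.ne_zero μ) • (unipotentTorusGL hϖ.ne_zero ⊓ glInt n F)) *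
        (unipotentTorusGL hϖ.ne_zero ⊓ glInt n F).relIndex
          (toConjAct (zpowDiagGL hϖ.ne_zero μ') • (unipotentTorusGL hϖ.ne_zero ⊓ glInt n F)) =
      (unipotentTorusGL hϖ.ne_zero ⊓ glInt n F).relIndex
          (toConjAct (zpowDiagGL hϖ.ne_zero (μ + μ')) • (unipotentTorusGL hϖ.ne_zero ⊓ glInt n F)) *
        (toConjAct (zpowDiagGL hϖ.ne_zero μ) • (unipotentTorusGL hϖ.ne_zero ⊓ glInt n F)).relIndex
          (unipotentTorusGL hϖ.ne_zero ⊓ glInt n F) *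
        (toConjAct (zpowDiagGL hϖ.ne_zero μ') • (unipotentTorusGL hϖ.ne_zero ⊓ glInt n F)).relIndex
          (unipotentTorusGL hϖ.ne_zero ⊓ glInt n F) := by
  rw [zpowDiagGL_add]
  exact IsIwasawaExponent.relIndex_conj_mul_conj (zpowDiagGL_mem_unipotentTorusGL hϖ.ne_zero μ)
    (zpowDiagGL_mem_unipotentTorusGL hϖ.ne_zero μ')

end Duality

/-! ## §3 The transforms over a commutative ring -/

/-- **`𝒮_w(T_g) = ι(𝒮_{w'}(T_{g⁻¹}))` for `GL_n`** over any commutative ring `R`, for any weights `w, w'` with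
`[U(𝒪) : U(𝒪) ∩ ϖ^μU(𝒪)ϖ^{-μ}] · w(e t) = [ϖ^μU(𝒪)ϖ^{-μ} : U(𝒪) ∩ ϖ^μU(𝒪)ϖ^{-μ}] · w'(-e t)` on `t ∈ N·A` and those indices
non-zero-divisors in `R` (e.g. `w = w' = δ_B^{-1/2}` when `√q ∈ Rˣ`): the transform intertwines `T_g ↦ T_{g⁻¹}` with the
antipode. [cite: CartierCorvallis1979, §IV (4.2), Thm. 4.1] -/
theorem satakeTransform_gl_doubleCosetOperator_eq_domCongr_neg [IsDiscreteValuationRing 𝒪[F]] {ϖ : F}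
    (hϖ : IsUniformizingElement ϖ) [IsHeckeTriple (⊤ : Submonoid (GL (Fin n) F)) (glInt n F) (glInt n F)]
    {R : Type*} [CommRing R] (w w' : Multiplicative (Fin n → ℤ) →* R)
    (hw : ∀ t ∈ unipotentTorusGL (n := n) hϖ.ne_zero,
      (((toConjAct t • (unipotentTorusGL hϖ.ne_zero ⊓ glInt n F)).relIndex (unipotentTorusGL hϖ.ne_zero ⊓ glInt n F) : ℕ) : R) *
          w (Multiplicative.ofAdd (iwasawaExp hϖ t)) =
        (((unipotentTorusGL hϖ.ne_zero ⊓ glInt n F).relIndex (toConjAct t • (unipotentTorusGL hϖ.ne_zero ⊓ glInt n F)) : ℕ) : R) *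
          w' (Multiplicative.ofAdd (-iwasawaExp hϖ t)))
    (hreg : ∀ t ∈ unipotentTorusGL (n := n) hϖ.ne_zero,
      (((toConjAct t • (unipotentTorusGL hϖ.ne_zero ⊓ glInt n F)).relIndex (unipotentTorusGL hϖ.ne_zero ⊓ glInt n F) : ℕ) : R) ∈
        nonZeroDivisors R)
    (g : GL (Fin n) F) :
    (isIwasawaExponent_gl hϖ).satakeTransform w (heckeAlgebra.doubleCosetOperator (glInt n F) g) =
      AddMonoidAlgebra.domCongr R R (AddEquiv.neg (Fin n → ℤ))
        ((isIwasawaExponent_gl hϖ).satakeTransform w' (heckeAlgebra.doubleCosetOperator (glInt n F) g⁻¹)) :=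
  (isIwasawaExponent_gl hϖ).satakeTransform_doubleCosetOperator_eq_domCongr_neg (exists_subgroup_relIndex_ne_zero_gl hϖ)
    w w' hw hreg g

end Literature.NumberTheory.Automorphic

end
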